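import Mathlib
import HarnessLib
import Literature.MathematicalPhysics.QuantumLattice.GaugeGroups
import Literature.LinearAlgebra.Matrix.UnitaryGroupMaximalTorus
import Literature.LinearAlgebra.Matrix.SpecialUnitaryGroupConjugacyClasses
import Summits.Ventures.LatticeQCDFlow.Exactness.CircleGroupJacobian
import Summits.Ventures.LatticeQCDFlow.Exactness.SpecialTorusCircleChart
import Summits.Ventures.LatticeQCDFlow.Exactness.TorusCubeChart

/-!
# The angle chart of `SΔ(n)` and the lattice `2πℤ^{n−1}`: fibres, injectivity on small sets, and invariance of the pushed-forward Lebesgue pieces under lattice translations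

HONEST FRAMING: exact (Metropolis-corrected) sampling algorithms for lattice gauge theory;
figures of merit are autocorrelation/cost numbers at stated couplings and volumes; no
continuum-physics claim.

Venture `LatticeQCDFlow` (cell pub-lqcd), topic `Exactness`; FANOUT row 10 (`eng-equiv`, engine
`latflow.equiv` `spectral.canonicalise`: "eigen-phases in any order / any `2π` representative …
subtract `2π` from the `S` largest" — Algorithm 1 moves between lattice translates of the alcove).
NEW WORK of the cell over Mathlib (`Circle.exp_eq_exp`, translation invariance of Lebesgue measure,
`MeasurableEmbedding.restrict_map`) and this row's `SpecialTorusCircleChart.lean` / `TorusCubeChart.lean`.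
Nothing is cited as a fact; no number; no definition.  Tools for step 2b of the `N ≥ 3` alcove programme
(LEANMAP-eng-equiv-gen8 §C′): the alcove in angle coordinates is not inside the cube `(−π,π]^{n−1}`, and
its pieces are moved back by lattice vectors.

## What is typed (`κ` finite; `E(θ) = schart (e^{iθ_k})_k` for any `schart` with free entries `z`)

* `cubeExp_eq_iff` — `(e^{iθ_k})_k = (e^{iθ'_k})_k ↔ ∀ k, θ_k − θ'_k ∈ 2πℤ`; `cubeExp_add_lattice`;
* **`cubeChart_eq_iff`** — `E θ = E θ' ↔ ∀ k, ∃ m_k ∈ ℤ, θ_k = θ'_k + 2π m_k` (the fibres of the angle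
  chart are the lattice cosets); `cubeChart_add_lattice` (`E` is `2πℤ^{n−1}`-periodic);
* **`injOn_cubeChart_of_abs_sub_lt`** — `E` is injective on any set whose coordinate differences are
  `< 2π` (every alcove chamber, every translate of the cube);
* **`map_cubeChart_restrict_image_add_lattice`** — for measurable `S` and a lattice vector `v = 2πm`,
  `E_* (Leb|_{S + v}) = E_* (Leb|_S)`: a Lebesgue piece may be moved by a lattice vector without changing
  its image measure on the torus.

NOT here: the decomposition of the cube into the `n!` chambers (step 2b proper); any number.
-/

noncomputable section

namespace Summit.Ventures.LatticeQCDFlow.Exactness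

open MeasureTheory Set Real
open Literature.LinearAlgebra.Matrix
open Literature.MathematicalPhysics.QuantumFieldTheory (haarProbability)
open scoped ENNReal

/-! ## Fibres of the coordinatewise exponential -/

section Cube

variable {κ : Type*}

/-- `(e^{iθ_k})_k = (e^{iθ'_k})_k` iff the angle vectors differ by a lattice vector of `2πℤ^κ`. -/
theorem cubeExp_eq_iff (θ θ' : κ → ℝ) :
    (fun k => Circle.exp (θ k)) = (fun k => Circle.exp (θ' k)) ↔ ∀ k, ∃ m : ℤ, θ k = θ' k + m * (2 * π) := by
  constructor
  · intro h k
    exact Circle.exp_eq_exp.mp (congr_fun h k)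
  · intro h
    funext k
    exact Circle.exp_eq_exp.mpr (h k)

/-- Adding a lattice vector does not change `(e^{iθ_k})_k`. -/
theorem cubeExp_add_lattice (θ : κ → ℝ) (m : κ → ℤ) :
    (fun k => Circle.exp ((θ + fun k => (m k : ℝ) * (2 * π)) k)) = fun k => Circle.exp (θ k) :=
  (cubeExp_eq_iff _ _).mpr fun k => ⟨m k, by simp [Pi.add_apply]⟩

end Cube

/-! ## The angle chart of `SΔ(n)` -/

section Chart

variable {n : Type*} [Fintype n] [DecidableEq n] {i₀ : n}
  {schart : ({i : n // i ≠ i₀} → Circle) → specialDiagonalTorus n}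
  (he : ∀ z (i : {i : n // i ≠ i₀}),
    (((schart z : specialDiagonalTorus n) : Matrix.specialUnitaryGroup n ℂ) : Matrix n n ℂ) i i = (z i : ℂ))

include he

/-- **The fibres of the angle chart are the lattice cosets**:
`E θ = E θ' ↔ ∀ k, ∃ m_k ∈ ℤ, θ_k = θ'_k + 2π m_k`. -/
theorem cubeChart_eq_iff (θ θ' : {i : n // i ≠ i₀} → ℝ) :
    schart (fun k => Circle.exp (θ k)) = schart (fun k => Circle.exp (θ' k)) ↔
      ∀ k, ∃ m : ℤ, θ k = θ' k + m * (2 * π) := by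
  rw [← cubeExp_eq_iff]
  exact (circleChart_specialDiagonalTorus_bijective_continuous he).1.1.eq_iff

omit he in
/-- **The angle chart is `2πℤ^{n−1}`-periodic.** -/
theorem cubeChart_add_lattice (θ : {i : n // i ≠ i₀} → ℝ) (m : {i : n // i ≠ i₀} → ℤ) :
    schart (fun k => Circle.exp ((θ + fun k => (m k : ℝ) * (2 * π)) k)) = schart (fun k => Circle.exp (θ k)) := by
  rw [cubeExp_add_lattice]

/-- **Injectivity on small sets**: if all coordinate differences within `S` are `< 2π` in absolute value,
the angle chart is injective on `S` (every chamber of the alcove decomposition, every translate of the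
cube `(−π, π]^{n−1}`). -/
theorem injOn_cubeChart_of_abs_sub_lt {S : Set ({i : n // i ≠ i₀} → ℝ)}
    (hS : ∀ θ ∈ S, ∀ θ' ∈ S, ∀ k, |θ k - θ' k| < 2 * π) :
    InjOn (fun θ : {i : n // i ≠ i₀} → ℝ => schart fun k => Circle.exp (θ k)) S := by
  intro θ hθ θ' hθ' h
  have hk := (cubeChart_eq_iff he θ θ').mp h
  funext k
  obtain ⟨m, hm⟩ := hk k
  have hlt := hS θ hθ θ' hθ' k
  rw [hm, add_sub_cancel_left, abs_mul, abs_of_pos (by positivity : (0 : ℝ) < 2 * π)] at hlt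
  have hm1 : |(m : ℝ)| < 1 := by
    by_contra hge
    rw [not_lt] at hge
    have : (1 : ℝ) * (2 * π) ≤ |(m : ℝ)| * (2 * π) := mul_le_mul_of_nonneg_right hge (by positivity)
    linarith
  have hm0 : m = 0 := by
    have : |m| < 1 := by exact_mod_cast hm1
    exact Int.abs_lt_one_iff.mp this
  rw [hm, hm0]
  simp

/-- **Lattice translates of a Lebesgue piece have the same image measure on the torus**: for a
measurable `S ⊆ ℝ^{n−1}` and a lattice vector `v = 2πm`, `E_*(Leb|_{S + v}) = E_*(Leb|_S)`. -/
theorem map_cubeChart_restrict_image_add_lattice (m : {i : n // i ≠ i₀} → ℤ)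
    (S : Set ({i : n // i ≠ i₀} → ℝ)) :
    Measure.map (fun θ : {i : n // i ≠ i₀} → ℝ => schart fun k => Circle.exp (θ k))
        ((volume : Measure ({i : n // i ≠ i₀} → ℝ)).restrict
          ((fun θ => θ + fun k => (m k : ℝ) * (2 * π)) '' S)) =
      Measure.map (fun θ : {i : n // i ≠ i₀} → ℝ => schart fun k => Circle.exp (θ k))
        ((volume : Measure ({i : n // i ≠ i₀} → ℝ)).restrict S) := by
  set v : {i : n // i ≠ i₀} → ℝ := fun k => (m k : ℝ) * (2 * π) with hv
  have hEm : Measurable (fun θ : {i : n // i ≠ i₀} → ℝ => schart fun k => Circle.exp (θ k)) :=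
    (circleChart_specialDiagonalTorus_bijective_continuous he).2.2.comp measurable_cubeExp
  -- `Leb|_{S + v} = (· + v)_* Leb|_S` (translation invariance)
  have htr : (volume : Measure ({i : n // i ≠ i₀} → ℝ)).restrict ((fun θ => θ + v) '' S) =
      Measure.map (fun θ => θ + v) ((volume : Measure ({i : n // i ≠ i₀} → ℝ)).restrict S) := by
    have h1 := (MeasurableEquiv.addRight v).measurableEmbedding.restrict_map
      (volume : Measure ({i : n // i ≠ i₀} → ℝ)) ((fun θ => θ + v) '' S)
    rw [MeasurableEquiv.coe_addRight, map_add_right_eq_self, (add_left_injective v).preimage_image] at h1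
    exact h1
  rw [htr, Measure.map_map hEm (measurable_add_const v)]
  congr 1
  funext θ
  simp only [Function.comp_apply]
  exact cubeChart_add_lattice θ m

end Chart

end Summit.Ventures.LatticeQCDFlow.Exactness
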